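import Summits.NavierStokesRegularity.NavierStokesRegularity.Theorems.QuantisedSymmetryLiouvilleKillsProfile
import Summits.NavierStokesRegularity.NavierStokesRegularity.Theorems.QuantisedSymmetryPolyhedralTruncationBridge

/-!
# Strategist sketch s19-g11 — independent STRATEGY CENSUS signatures for
`QuantisedSymmetry.PolyhedralDssProfileExists` (stmt-NavierStokesRegularity-1404)

Signatures only (defs) + the trivial logical links the census refers to.  No new route, no new
stub registered: every candidate below is shown in `STRATEGY-CENSUS-s19.md` to give no leverage.
-/

namespace Summit.NavierStokesRegularity.NavierStokesRegularity.Cruxes.PolyhedralDssProfileExists.S19g11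

open MeasureTheory
open Summit.NavierStokesRegularity.NavierStokesRegularity.Theses.QuantisedSymmetry

/-- Local abbreviation for `ℝ³`. -/
abbrev E3 := EuclideanSpace ℝ (Fin 3)

/-- The polyhedral frame predicate of the crux: `G` finite, proper rotations, irreducible on ℝ³
(so `G` is conjugate to the chiral tetrahedral / octahedral / icosahedral group). -/
def IsPolyhedralFrame (G : Subgroup (E3 ≃ₗᵢ[ℝ] E3)) : Prop :=
  Finite G ∧ (∀ g ∈ G, LinearMap.det (g.toLinearEquiv : E3 →ₗ[ℝ] E3) = 1) ∧
    (∀ V : Submodule ℝ E3, (∀ g ∈ G, ∀ v ∈ V, g v ∈ V) → V = ⊥ ∨ V = ⊤)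

/-- The analytic clause of the crux for a given group `G` and factor `c`:
a nontrivial `G`-equivariant Type-I `c`-DSS ancient mild solution. -/
def IsEquivariantDssProfile (G : Subgroup (E3 ≃ₗᵢ[ℝ] E3)) (c : ℝ) (u : ℝ → E3 → E3) : Prop :=
  Literature.Analysis.FluidPDE.IsAncientMildSolution 1 u ∧ (∀ t < 0, AEStronglyMeasurable (u t) volume) ∧
    Literature.Analysis.FluidPDE.IsDiscretelySelfSimilar c u ∧
    (∃ C₀ : ℝ, Literature.Analysis.FluidPDE.HasTypeIDecay C₀ u) ∧ (∀ g ∈ G, ∀ t x, u t (g x) = g (u t x)) ∧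
    ¬ (∀ t < 0, u t =ᵐ[volume] 0)

/-- The crux, refolded through the two local predicates (checked equal to the route decl below). -/
theorem crux_iff :
    PolyhedralDssProfileExists ↔
      ∃ G : Subgroup (E3 ≃ₗᵢ[ℝ] E3), IsPolyhedralFrame G ∧ ∃ c : ℝ, 1 < c ∧ ∃ u, IsEquivariantDssProfile G c u := by
  constructor
  · rintro ⟨G, hfin, hdet, hirr, c, hc, u, h1, h2, h3, h4, h5, h6⟩
    exact ⟨G, ⟨hfin, hdet, hirr⟩, c, hc, u, ⟨h1, h2, h3, h4, h5, h6⟩⟩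
  · rintro ⟨G, ⟨hfin, hdet, hirr⟩, c, hc, u, ⟨h1, h2, h3, h4, h5, h6⟩⟩
    exact ⟨G, hfin, hdet, hirr, c, hc, u, h1, h2, h3, h4, h5, h6⟩

/-! ## §0 Weaker intermediates (from the summit statement) -/

/-- **W1** — the crux with the polyhedral clauses deleted: a nontrivial Type-I DSS ancient mild
solution with no symmetry requirement (Tsai's backward-DSS existence question; = the hypothesis of
`FilamentSkeletonRss.RdssProfileTruncation` with `R = 1`).  `C → W1` (below); `W1 → ¬NSR` is a
TREE THEOREM (rdssProfileTruncation + ClayUniqueness), so W1 is logically weaker than C but still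
decides the summit: it is not an intermediate "short of the summit". -/
def W1_DssProfileExists : Prop :=
  ∃ c : ℝ, 1 < c ∧ ∃ u : ℝ → E3 → E3, Literature.Analysis.FluidPDE.IsAncientMildSolution 1 u ∧
    (∀ t < 0, AEStronglyMeasurable (u t) volume) ∧ Literature.Analysis.FluidPDE.IsDiscretelySelfSimilar c u ∧
    (∃ C₀ : ℝ, Literature.Analysis.FluidPDE.HasTypeIDecay C₀ u) ∧ ¬ (∀ t < 0, u t =ᵐ[volume] 0)

theorem W1_of_crux : PolyhedralDssProfileExists → W1_DssProfileExists := by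
  rintro ⟨G, -, -, -, c, hc, u, hmild, hmeas, hdss, hdec, -, hnt⟩
  exact ⟨c, hc, u, hmild, hmeas, hdss, hdec, hnt⟩

/-- **W1 already decides the summit** (kernel-checked here from TREE THEOREMS only:
`filamentSkeletonRss_rdssProfileTruncation_proof` (stmt-11289, rotation `R = refl`) and
`ClayUniqueness_holds` (stmt-0153), composed as in the route's `closes`).  Hence the polyhedral
clauses of C are not load-bearing for `¬NSR`, and W1 — though logically weaker than C — is not an
intermediate "short of the summit". -/
theorem W1_decides_summit : W1_DssProfileExists → ¬ _root_.NavierStokesRegularity := by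
  rintro ⟨c, hc, w, hanc, hmeas, hdss, hdec, hnt⟩ hA
  have hrdss : Literature.Analysis.FluidPDE.IsRotatedDSS c (LinearIsometryEquiv.refl ℝ E3) w :=
    Literature.Analysis.FluidPDE.isRotatedDSS_refl_iff.mpr hdss
  obtain ⟨ν, hν, T, hT, u, p, ⟨hcl, hmax⟩, hLH, hdecay⟩ :=
    _root_.Summit.NavierStokesRegularity.NavierStokesRegularity.Theorems.filamentSkeletonRss_rdssProfileTruncation_proof
      ⟨c, LinearIsometryEquiv.refl ℝ E3, w, hc, hanc, hmeas, hrdss, hdec, hnt⟩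
  have h0 : (0 : ℝ) ∈ Set.Ico 0 T := ⟨le_rfl, hT⟩
  obtain ⟨u', p', hu', hp', hns, hbe⟩ :=
    hA ν hν (u 0) (hcl.contDiff_velocity h0) (hcl.divFree 0 h0) hdecay
  have heq : ∀ t ∈ Set.Ico 0 T, u' t = u t :=
    ClayUniqueness_holds ν hν (u 0) hdecay u' u p' p T hT hu' hp' hns hbe hcl hLH rfl
  have hcl' : Literature.Analysis.FluidPDE.IsClassicalNSSolutionOn (Set.Ici 0) ν 0 u' p' :=
    ⟨hu', hp', fun t ht x => hns.momentum t ht x, fun t ht => hns.divFree t ht⟩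
  refine hmax ⟨T + 1, by linarith, u', p', ?_, heq⟩
  exact hcl'.mono (fun t ht => ht.1) (uniqueDiffOn_Ico 0 (T + 1))

/-- **W3_G** — the first consequence of C that is NOT known to give `¬NSR`: a nontrivial
`G`-equivariant bounded ancient mild solution with Type-I space-time decay and NO self-similarity
(the negation-form of the route's kill switch `PolyhedralTypeILiouville`, stmt-1405; the T/O/I case
of ¬(weak KNSS Liouville)).  Off the proved path in both directions: no `W3_G → ¬NSR` bridge exists
(AlbrittonBarker2019 Thm 1.1 goes the other way) and `W3_G → C` is the missing DSS-selection
principle (§Decomposition). -/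
def W3G_EquivariantTypeIAncientExists : Prop :=
  ∃ G : Subgroup (E3 ≃ₗᵢ[ℝ] E3), IsPolyhedralFrame G ∧ ∃ u : ℝ → E3 → E3,
    Literature.Analysis.FluidPDE.IsBoundedAncientMildSolution 1 u ∧ (∀ t < 0, AEStronglyMeasurable (u t) volume) ∧
    (∃ C₀ : ℝ, Literature.Analysis.FluidPDE.HasTypeIDecay C₀ u) ∧ (∀ g ∈ G, ∀ t x, u t (g x) = g (u t x)) ∧
    ¬ (∀ t < 0, u t =ᵐ[volume] 0)

theorem not_liouville_of_W3G : W3G_EquivariantTypeIAncientExists → ¬ PolyhedralTypeILiouville := by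
  rintro ⟨G, ⟨hfin, hdet, hirr⟩, u, hb, hmeas, hdec, heq, hnt⟩ hL
  exact hnt (hL G hfin hdet hirr u hb hmeas hdec heq)

theorem W3G_of_not_liouville : ¬ PolyhedralTypeILiouville → W3G_EquivariantTypeIAncientExists := by
  intro h
  by_contra hW
  apply h
  intro G hfin hdet hirr u hb hmeas hdec heq
  by_contra hnt
  exact hW ⟨G, ⟨hfin, hdet, hirr⟩, u, hb, hmeas, hdec, heq, hnt⟩

/-- `C → W3_G`, through the landed kill-switch theorem (stmt-1408, LiouvilleKillsProfile). -/
theorem W3G_of_crux : PolyhedralDssProfileExists → W3G_EquivariantTypeIAncientExists := by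
  intro hC
  apply W3G_of_not_liouville
  intro hL
  exact _root_.Summit.NavierStokesRegularity.NavierStokesRegularity.Theorems.quantisedSymmetry_liouvilleKillsProfile_proof
    hL hC

/-! ## §Decomposition — the best typed split: the DSS-selection dichotomy -/

/-- Piece 2 of the split `C ⇐ W3_G ∧ (W3_G → C)`: **DSS selection** — among nontrivial
polyhedral Type-I ancient solutions one is (after symmetry reduction / a tangent-flow limit)
discretely self-similar.  Equivalent to the dichotomy `PolyhedralTypeILiouville ∨ C`.  This is the
Giga–Kohn step ("Type-I blow-up limits are self-similar") that NS lacks: no monotone weighted energy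
(barrier GaussianMonotonicityVertexDivergence). -/
def DssSelection : Prop :=
  W3G_EquivariantTypeIAncientExists → PolyhedralDssProfileExists

theorem dssSelection_iff_dichotomy : DssSelection ↔ (PolyhedralTypeILiouville ∨ PolyhedralDssProfileExists) := by
  constructor
  · intro h
    by_cases hL : PolyhedralTypeILiouville
    · exact Or.inl hL
    · exact Or.inr (h (W3G_of_not_liouville hL))
  · rintro (hL | hC) hW
    · exact absurd hL (not_liouville_of_W3G hW)
    · exact hC

/-- The split's assembly (modus ponens; a trivial seam, which is allowed — what fails is that
piece 2 has no engine and piece 1 is an open Liouville-type existence problem of the same kind). -/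
theorem crux_of_split : W3G_EquivariantTypeIAncientExists → DssSelection → PolyhedralDssProfileExists :=
  fun hW hSel => hSel hW

/-! ## §Strengthen — S⁺: an ISOLATED (non-degenerate) polyhedral DSS profile -/

/-- **S⁺** — a nontrivial polyhedral Type-I DSS profile which is moreover *isolated modulo the
scaling phase*: every profile with the same `(G, c)` that is `L⁴`-close on the fundamental slab
`[-1, -c⁻²]` is a parabolic rescaling of it.  (The typable shadow of "1 is not a Floquet
multiplier of the linearised period map modulo the orbit tangent"; it is what a Newton–Kantorovich
certificate would actually prove.)  `S⁺ → C` by forgetting isolation; the added rigidity buys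
persistence / certifiability of a profile one already has, not existence. -/
def SPlus_IsolatedProfile : Prop :=
  ∃ G : Subgroup (E3 ≃ₗᵢ[ℝ] E3), IsPolyhedralFrame G ∧ ∃ c : ℝ, 1 < c ∧ ∃ u : ℝ → E3 → E3,
    IsEquivariantDssProfile G c u ∧
    ∃ ε : ℝ, 0 < ε ∧ ∀ w : ℝ → E3 → E3, IsEquivariantDssProfile G c w →
      (∀ t ∈ Set.Icc (-1 : ℝ) (-(c ^ 2)⁻¹), eLpNorm (fun x => w t x - u t x) 4 volume < ENNReal.ofReal ε) →
      ∃ μ : ℝ, 0 < μ ∧ ∀ t < 0, ∀ x, w t x = μ • u (μ ^ 2 * t) (μ • x)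

theorem crux_of_SPlus : SPlus_IsolatedProfile → PolyhedralDssProfileExists := by
  rintro ⟨G, hG, c, hc, u, hu, -⟩
  exact crux_iff.mpr ⟨G, hG, c, hc, u, hu⟩

/-! ## §Decomposition (bis) — the certificate split C ⇐ P1 ∧ P2 (computer-assisted shape) -/

/-- **P2** (support, KNOWN): the radii-polynomial / Newton–Kantorovich schema on a Banach space —
if the Newton-like map `x ↦ x - A (T x - x)` is a `Z`-Lipschitz self-map of a ball with `Z < 1`,
it has a fixed point there, i.e. `A (T x - x) = 0` (Banach; with `A` injective, `T x = x`).
Typed abstractly; Mathlib's `ContractingWith.fixedPoint` proves it.  All NS content is in P1. -/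
def P2_NewtonKantorovichSchema : Prop :=
  ∀ (X : Type) [NormedAddCommGroup X] [NormedSpace ℝ X] [CompleteSpace X]
    (T : X → X) (A : X →L[ℝ] X) (x₀ : X) (Y Z r : ℝ),
    0 ≤ Y → 0 ≤ Z → Z < 1 → 0 < r → Y + Z * r ≤ r →
    ‖A (T x₀ - x₀)‖ ≤ Y →
    (∀ x ∈ Metric.closedBall x₀ r, ∀ y ∈ Metric.closedBall x₀ r,
        ‖(x - A (T x - x)) - (y - A (T y - y))‖ ≤ Z * ‖x - y‖) →
    ∃ x ∈ Metric.closedBall x₀ r, A (T x - x) = 0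

/-- **P1** (the ∃-certificate; schematic): validated data `(G, c, x₀, A, Y, Z, r)` for the
symmetry-reduced period map `T = 𝓡_{G,c}` (slab mild flow on `[-1,-c⁻²]` followed by the
`c`-rescaling, acting on `G`-equivariant divergence-free `L⁴ ∩ L^{3,∞}` slices), with `Z < 1`,
`Y + Z r ≤ r`, `x₀ ≠ 0` separated from `0` by more than `r`, and `A` injective.  Its honest Lean
form quantifies EXISTENTIALLY over the approximate profile `x₀` — and `∃ x₀ …` with a valid
certificate is `SPlus_IsolatedProfile` in disguise (an isolated fixed point exists), i.e. C
strengthened: the split is costume unless a CONCRETE `x₀` is in hand, and none is (no numerical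
backward-DSS candidate in print, EVENMAP hunt not run in 3-D).  Recorded here as the statement the
census rejects; deliberately left as `SPlus_IsolatedProfile` rather than a new decl. -/
def P1_CertificateExists : Prop := SPlus_IsolatedProfile

end Summit.NavierStokesRegularity.NavierStokesRegularity.Cruxes.PolyhedralDssProfileExists.S19g11
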